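import Summits.AtomisticToContinuum.FouriersLaw.Theorems.LatticeLandauDampingAbelThermodynamicLimitOfUniformAbelianRegularity
import Summits.AtomisticToContinuum.FouriersLaw.Theorems.EmbeddedDrudeMourreAbelOfSpectralDensity
import HarnessLib

/-!
# Line `window-regularity` — ALTERNATIVE skeleton for crux `LatticeLandauDamping.AbelThermodynamicLimit`
(stmt-AtomisticToContinuum-14013; crux-strategist s2, 2026-08-17; registered with `--alt` semantics: the lead's skeleton slot
`Lines/SketchIdeator2.lean` is untouched)

Crux (FIXED, the route decl by name): for `P = pinnedChain ω₂ lam β γ` (all `> 0`), under weak-NESS uniqueness and `T > 0`,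
IF an Abelian Green–Kubo witness `(μT, D, κ)` exists at `T` THEN some witness has `Dn → κ` for every steady family and every
response sequence.

## Idea (one paragraph; which stub is load-bearing)
Every registered line of this crux and of its `Iff.rfl` twin stmt-12596 closes on (R) = `StaticAbelianSqueeze.UniformAbelianRegularity`
(stmt-13416) plus ONE more input that only serves to make the OUTPUT witness's Abel limit the right positive number: the seam SI
("WLOG the hypothesis witness is shift-invariant", undecidable standalone) or CLB = `ConductanceLowerBound` (stmt-11749, XL; the cut
filed on the twin's four routes).  On THIS route neither is the honest second input.  `LatticeLandauDamping.closes` feeds the crux the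
witness it builds in its step 0 from the three SPECTRAL cruxes `WindowDecomposition` (14011) / `NoDrudeWeight` (14012) /
`PositiveDensity` (14014) and the PROVED Poisson lemma `AbelOfSpectralDensity` (12598) — and that witness HAS a shift-invariant DLR
state (`WindowDecomposition` quantifies `∀ x, MeasurePreserving (σ ↦ σ (· + x)) μT μT`); `closes` merely forgets it.  So the
honest second stub is the route's own spectral output in its honest form, `stub_abelGreenKuboSI` = the target `AbelGreenKubo`
(14010) WITH `IsShiftInvariant μT` — PROVED below from the three spectral cruxes (`abelGreenKuboSI_of_window`, sorry-free) — and the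
composition DISCARDS the crux's γ-blind hypothesis witness and applies the landed p127738
`stub_repairedCruxOfUniformAbelianRegularity` ((R) ⇒ the shift-invariant-witness form of the crux) to the honest one.
Load-bearing: `stub_uniformAbelianRegularity` (= stmt-13416, led in its own chain).  Cone of the crux on this line:
{stmt-13416, stmt-14011, stmt-14012, stmt-14014} — four EXISTING items of which three are this route's own cruxes (in the cone of
`closes` anyway): NO seam, NO CLB, nothing new to staff (`AbelThermodynamicLimit_of_items`, `fouriersLaw_of_items`).

## Why it dodges the STUCK goals of the live line (SketchIdeator2 rev 15: QS, QSR, SI, uniformSignedTail, CLB)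
QS / QSR (conjectural sign laws, strengthenings of (R)): not used.  SI: replaced by a THEOREM (`witnessShiftInvariant_of_abelGreenKuboSI`
∘ `abelGreenKuboSI_of_window`).  CLB: not used — positivity is `PositiveDensity`'s `g 0 > 0`, which this route owes anyway.
`stub_uniformSignedTail` ⊂ (R): shared, unchanged (the one real difficulty; nothing here claims to move it).

## Disproof used (`Cruxes/AbelThermodynamicLimit/Disproof.lean`, verdict `resists`, no `-- Targets`; re-read 2026-08-17T09:4xZ)
§2 `exists_witness_iff_gamma`: the hypothesis witness is γ-blind — honoured trivially (it is discarded); `0 < γ` and `Uniq` act only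
inside p127738 through the landed (K) `kuboAbelIdentity_holds`, as §2 says any proof must.  §2c `tlconv_harmonic_false`: (R) is false
at `lam = β = 0` — both stubs carry `0 < lam`, `0 < β`.  §3 `hasBoundedResponse_of_crux'`: paid by (R) (its upper half).  §7.2 sign-law
kill criteria: not applicable (no sign law).  Landed `Negative/LoadBearing.lean`, `Negative/SignLawsKillCriteria.lean`: no shortcut for
either stub (checked: they concern the crux shape / abstract sequences).
-/

noncomputable section

namespace Summit.AtomisticToContinuum.FouriersLaw.Cruxes.AbelThermodynamicLimit.WindowRegularity

open MeasureTheory Filter Set Topology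
open Literature.MathematicalPhysics.KineticTheory.HeatConduction
open Summit.AtomisticToContinuum.FouriersLaw.Theses.LatticeLandauDamping

/-! ## Registered stubs (`sorry` only here) -/

/-- **Stub (R) — `stub_uniformAbelianRegularity`: UNIFORM ABELIAN REGULARITY, verbatim BY NAME the crux of route
`StaticAbelianSqueeze`** (item stmt-AtomisticToContinuum-13416, open-problem class, led in its own crux chain; shared verbatim with
`Lines/SketchIdeator2.lean` rev 10+, `Lines/exchange_and_positivity.lean`, `Lines/loomis_compact_horizon_witness.lean` rev 5): for `P`
(all `> 0`) and `T > 0`, `∀ ε > 0 ∃ ν₀ > 0 ∀ ν ∈ (0, ν₀)`, eventually in `N`, `|∫₀^∞ (1 − e^{-νt}) c_N(t) dt| ≤ εN` for the open chain's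
equilibrium total-current autocorrelation `c_N`.  The `ν ↓ 0 ↔ N → ∞` exchange; THE load-bearing stub. -/
theorem stub_uniformAbelianRegularity :
    Summit.AtomisticToContinuum.FouriersLaw.Theses.StaticAbelianSqueeze.UniformAbelianRegularity := by
  sorry

/-- **Stub X — `stub_abelGreenKuboSI`: THE HONEST ABELIAN GREEN–KUBO WITNESS** (= this route's target `AbelGreenKubo`, stmt-14010,
with `IsShiftInvariant μT` restored): for `P` (all `> 0`) and every `T > 0` there are a SHIFT-INVARIANT DLR Gibbs state `μT`, a
`μT`-preserving infinite-volume dynamics with absolutely convergent current correlations and `κ > 0` with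
`T⁻² ∫₀^∞ e^{-νt} C_T(t) dt → κ` as `ν ↓ 0`.  PROVED below from this route's three spectral cruxes (`abelGreenKuboSI_of_window`);
registered as a stub so that the line's cone is machine-visible and so that other routes' engines (Guarneri escape profile,
Drude dissolution + continuation) can supply it too.  γ-blind, as the closed chain is. -/
theorem stub_abelGreenKuboSI :
    ∀ ω₂ lam β γ : ℝ, 0 < ω₂ → 0 < lam → 0 < β → 0 < γ → ∀ T : ℝ, 0 < T →
      ∃ (μT : MeasureTheory.Measure Literature.MathematicalPhysics.KineticTheory.HeatConduction.ChainConfig)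
        (D : Literature.MathematicalPhysics.KineticTheory.HeatConduction.InfiniteChainDynamics
          (Literature.MathematicalPhysics.KineticTheory.HeatConduction.pinnedChain ω₂ lam β γ)) (κ : ℝ),
        (Literature.MathematicalPhysics.KineticTheory.HeatConduction.pinnedChain ω₂ lam β γ).IsChainGibbsMeasure T μT ∧
        Literature.MathematicalPhysics.KineticTheory.HeatConduction.IsShiftInvariant μT ∧
        D.PreservesMeasure μT ∧
        (∀ t : ℝ, D.HasAbsConvergentCorrelation μT t) ∧ 0 < κ ∧
        Filter.Tendsto (fun ν : ℝ => (T ^ 2)⁻¹ *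
          MeasureTheory.integral (MeasureTheory.volume.restrict (Set.Ioi (0:ℝ)))
            (fun t : ℝ => Real.exp (-(ν * t)) * (D.currentCorrelation μT) t))
          (nhdsWithin (0:ℝ) (Set.Ioi 0)) (nhds κ) := by
  sorry

/-! ## Composition — the crux BY NAME (real proof; sorries only inside the two stubs) -/

/-- **`AbelThermodynamicLimit_of`**: the crux from (R) and the honest witness.  DISCARD the γ-blind hypothesis witness; take the
shift-invariant one from `stub_abelGreenKuboSI`; apply the LANDED p127738 `stub_repairedCruxOfUniformAbelianRegularity`
((R) ⇒ the planner-repaired crux: regularise the witness, landed fixed-frequency matching, landed (K), the exchange = (R)). -/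
theorem AbelThermodynamicLimit_of :
    Summit.AtomisticToContinuum.FouriersLaw.Theses.LatticeLandauDamping.AbelThermodynamicLimit := by
  intro ω₂ lam β γ hω hl hβ hγ hU T hT _hex
  exact
    Summit.AtomisticToContinuum.FouriersLaw.Theorems.AbelThermodynamicLimit.SeriesLawAtEveryLaplaceFrequency.stub_repairedCruxOfUniformAbelianRegularity
      stub_uniformAbelianRegularity ω₂ lam β γ hω hl hβ hγ hU T hT (stub_abelGreenKuboSI ω₂ lam β γ hω hl hβ hγ T hT)

/-! ## Record theorems (sorry-free): the second stub is this route's own spectral output; the cone over ITEMS only -/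

/-- Lattice-shift invariance in the route's form gives `IsShiftInvariant` (`μ.map shift = μ`). [folklore] -/
theorem isShiftInvariant_of_measurePreserving_shifts {μT : Measure ChainConfig}
    (hshift : ∀ x : ℤ, MeasurePreserving (fun σ : ChainConfig => fun i : ℤ => σ (i + x)) μT μT) :
    IsShiftInvariant μT := by
  show μT.map shift = μT
  have hfun : (shift : ChainConfig → ChainConfig) = fun σ : ChainConfig => fun i : ℤ => σ (i + 1) := by
    funext σ i
    rfl
  rw [hfun]
  exact (hshift 1).map_eq

/-- **Stub X is PROVED from the route's three spectral cruxes** (the PROVED Poisson lemma supplied): verbatim step 0 of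
`LatticeLandauDamping.closes` / the landed `abelGreenKuboOfWindow_proof` (p87901), keeping the shift-invariance. [folklore] -/
theorem abelGreenKuboSI_of_window (hW : WindowDecomposition) (hND : NoDrudeWeight) (hPD : PositiveDensity) :
    ∀ ω₂ lam β γ : ℝ, 0 < ω₂ → 0 < lam → 0 < β → 0 < γ → ∀ T : ℝ, 0 < T →
      ∃ (μT : MeasureTheory.Measure Literature.MathematicalPhysics.KineticTheory.HeatConduction.ChainConfig)
        (D : Literature.MathematicalPhysics.KineticTheory.HeatConduction.InfiniteChainDynamics
          (Literature.MathematicalPhysics.KineticTheory.HeatConduction.pinnedChain ω₂ lam β γ)) (κ : ℝ),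
        (Literature.MathematicalPhysics.KineticTheory.HeatConduction.pinnedChain ω₂ lam β γ).IsChainGibbsMeasure T μT ∧
        Literature.MathematicalPhysics.KineticTheory.HeatConduction.IsShiftInvariant μT ∧
        D.PreservesMeasure μT ∧
        (∀ t : ℝ, D.HasAbsConvergentCorrelation μT t) ∧ 0 < κ ∧
        Filter.Tendsto (fun ν : ℝ => (T ^ 2)⁻¹ *
          MeasureTheory.integral (MeasureTheory.volume.restrict (Set.Ioi (0:ℝ)))
            (fun t : ℝ => Real.exp (-(ν * t)) * (D.currentCorrelation μT) t))
          (nhdsWithin (0:ℝ) (Set.Ioi 0)) (nhds κ) := by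
  intro ω₂ lam β γ hω hl hβ hγ T hT
  obtain ⟨μT, D, hGibbs, hshift, hpres, habs, σ, hfin, hC, δ, g, hδ, hg, hg0, hres⟩ :=
    hW ω₂ lam β γ hω hl hβ hγ T hT
  have h0 : σ {0} = 0 :=
    hND ω₂ lam β γ hω hl hβ hγ T hT μT D hGibbs hshift hpres habs σ hfin hC
  rw [h0, zero_smul, zero_add] at hres
  have hpos : 0 < g 0 :=
    hPD ω₂ lam β γ hω hl hβ hγ T hT μT D hGibbs hshift hpres habs σ δ g hfin hδ hC hg hg0 hres
  have hlim :=
    Summit.AtomisticToContinuum.FouriersLaw.Theorems.AbelOfSpectralDensity.latticeLandauDamping_abelOfSpectralDensity_proof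
      σ (D.currentCorrelation μT) δ g hfin hδ hC hg hg0 hres
  exact ⟨μT, D, (T ^ 2)⁻¹ * (Real.pi * g 0), hGibbs, isShiftInvariant_of_measurePreserving_shifts hshift, hpres, habs,
    by positivity, hlim.const_mul ((T ^ 2)⁻¹)⟩

/-- The live line's seam SI (`stub_witnessShiftInvariant` of `Lines/SketchIdeator2.lean`, verbatim statement) is a COROLLARY of
stub X (ignore SI's hypothesis). [folklore] -/
theorem witnessShiftInvariant_of_abelGreenKuboSI
    (hX : ∀ ω₂ lam β γ : ℝ, 0 < ω₂ → 0 < lam → 0 < β → 0 < γ → ∀ T : ℝ, 0 < T →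
      ∃ (μT : MeasureTheory.Measure Literature.MathematicalPhysics.KineticTheory.HeatConduction.ChainConfig)
        (D : Literature.MathematicalPhysics.KineticTheory.HeatConduction.InfiniteChainDynamics
          (Literature.MathematicalPhysics.KineticTheory.HeatConduction.pinnedChain ω₂ lam β γ)) (κ : ℝ),
        (Literature.MathematicalPhysics.KineticTheory.HeatConduction.pinnedChain ω₂ lam β γ).IsChainGibbsMeasure T μT ∧
        Literature.MathematicalPhysics.KineticTheory.HeatConduction.IsShiftInvariant μT ∧
        D.PreservesMeasure μT ∧
        (∀ t : ℝ, D.HasAbsConvergentCorrelation μT t) ∧ 0 < κ ∧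
        Filter.Tendsto (fun ν : ℝ => (T ^ 2)⁻¹ *
          MeasureTheory.integral (MeasureTheory.volume.restrict (Set.Ioi (0:ℝ)))
            (fun t : ℝ => Real.exp (-(ν * t)) * (D.currentCorrelation μT) t))
          (nhdsWithin (0:ℝ) (Set.Ioi 0)) (nhds κ)) :
    ∀ ω₂ lam β γ : ℝ, 0 < ω₂ → 0 < lam → 0 < β → 0 < γ → ∀ T : ℝ, 0 < T →
      (∃ (μT : MeasureTheory.Measure Literature.MathematicalPhysics.KineticTheory.HeatConduction.ChainConfig)
          (D' : Literature.MathematicalPhysics.KineticTheory.HeatConduction.InfiniteChainDynamics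
            (Literature.MathematicalPhysics.KineticTheory.HeatConduction.pinnedChain ω₂ lam β γ)) (κ : ℝ),
          (Literature.MathematicalPhysics.KineticTheory.HeatConduction.pinnedChain ω₂ lam β γ).IsChainGibbsMeasure T μT ∧
          D'.PreservesMeasure μT ∧ (∀ t : ℝ, D'.HasAbsConvergentCorrelation μT t) ∧ 0 < κ ∧
          Filter.Tendsto (fun ν : ℝ => (T ^ 2)⁻¹ *
            MeasureTheory.integral (MeasureTheory.volume.restrict (Set.Ioi (0:ℝ)))
              (fun t : ℝ => Real.exp (-(ν * t)) * D'.currentCorrelation μT t))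
            (nhdsWithin (0:ℝ) (Set.Ioi 0)) (nhds κ)) →
      ∃ (μT : MeasureTheory.Measure Literature.MathematicalPhysics.KineticTheory.HeatConduction.ChainConfig)
        (D' : Literature.MathematicalPhysics.KineticTheory.HeatConduction.InfiniteChainDynamics
          (Literature.MathematicalPhysics.KineticTheory.HeatConduction.pinnedChain ω₂ lam β γ)) (κ : ℝ),
        (Literature.MathematicalPhysics.KineticTheory.HeatConduction.pinnedChain ω₂ lam β γ).IsChainGibbsMeasure T μT ∧
        Literature.MathematicalPhysics.KineticTheory.HeatConduction.IsShiftInvariant μT ∧ D'.PreservesMeasure μT ∧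
        (∀ t : ℝ, D'.HasAbsConvergentCorrelation μT t) ∧ 0 < κ ∧
        Filter.Tendsto (fun ν : ℝ => (T ^ 2)⁻¹ *
          MeasureTheory.integral (MeasureTheory.volume.restrict (Set.Ioi (0:ℝ)))
            (fun t : ℝ => Real.exp (-(ν * t)) * D'.currentCorrelation μT t))
          (nhdsWithin (0:ℝ) (Set.Ioi 0)) (nhds κ) :=
  fun ω₂ lam β γ hω hl hβ hγ T hT _ => hX ω₂ lam β γ hω hl hβ hγ T hT

/-- Stub X implies the route's filed target `AbelGreenKubo` (stmt-14010) — forget the shift-invariance. [folklore] -/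
theorem abelGreenKubo_of_abelGreenKuboSI
    (hX : ∀ ω₂ lam β γ : ℝ, 0 < ω₂ → 0 < lam → 0 < β → 0 < γ → ∀ T : ℝ, 0 < T →
      ∃ (μT : MeasureTheory.Measure Literature.MathematicalPhysics.KineticTheory.HeatConduction.ChainConfig)
        (D : Literature.MathematicalPhysics.KineticTheory.HeatConduction.InfiniteChainDynamics
          (Literature.MathematicalPhysics.KineticTheory.HeatConduction.pinnedChain ω₂ lam β γ)) (κ : ℝ),
        (Literature.MathematicalPhysics.KineticTheory.HeatConduction.pinnedChain ω₂ lam β γ).IsChainGibbsMeasure T μT ∧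
        Literature.MathematicalPhysics.KineticTheory.HeatConduction.IsShiftInvariant μT ∧
        D.PreservesMeasure μT ∧
        (∀ t : ℝ, D.HasAbsConvergentCorrelation μT t) ∧ 0 < κ ∧
        Filter.Tendsto (fun ν : ℝ => (T ^ 2)⁻¹ *
          MeasureTheory.integral (MeasureTheory.volume.restrict (Set.Ioi (0:ℝ)))
            (fun t : ℝ => Real.exp (-(ν * t)) * (D.currentCorrelation μT) t))
          (nhdsWithin (0:ℝ) (Set.Ioi 0)) (nhds κ)) :
    AbelGreenKubo := by
  intro ω₂ lam β γ hω hl hβ hγ T hT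
  obtain ⟨μT, D, κ, hG, _hS, hP, hAC, hκ, hlim⟩ := hX ω₂ lam β γ hω hl hβ hγ T hT
  exact ⟨μT, D, κ, hG, hP, hAC, hκ, hlim⟩

/-- **The crux BY NAME over EXISTING ITEMS only**: (R) = stmt-13416 and this route's three spectral cruxes 14011 / 14012 / 14014
(the Poisson lemma 12598 and p127738 being landed).  No seam, no CLB. [folklore] -/
theorem AbelThermodynamicLimit_of_items
    (hR : Summit.AtomisticToContinuum.FouriersLaw.Theses.StaticAbelianSqueeze.UniformAbelianRegularity)
    (hW : WindowDecomposition) (hND : NoDrudeWeight) (hPD : PositiveDensity) :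
    Summit.AtomisticToContinuum.FouriersLaw.Theses.LatticeLandauDamping.AbelThermodynamicLimit := by
  intro ω₂ lam β γ hω hl hβ hγ hU T hT _hex
  exact
    Summit.AtomisticToContinuum.FouriersLaw.Theorems.AbelThermodynamicLimit.SeriesLawAtEveryLaplaceFrequency.stub_repairedCruxOfUniformAbelianRegularity
      hR ω₂ lam β γ hω hl hβ hγ hU T hT (abelGreenKuboSI_of_window hW hND hPD ω₂ lam β γ hω hl hβ hγ T hT)

/-- **Route-level record**: `FouriersLaw` from the three spectral cruxes and (R), through the route's own deciding theorem
`closes` and the landed `NessUnique_holds` / `FiniteResponseOfUnique_holds` — i.e. on this line the bridge crux costs the route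
NOTHING beyond stmt-13416. [folklore] -/
theorem fouriersLaw_of_items (hW : WindowDecomposition) (hND : NoDrudeWeight) (hPD : PositiveDensity)
    (hR : Summit.AtomisticToContinuum.FouriersLaw.Theses.StaticAbelianSqueeze.UniformAbelianRegularity) :
    _root_.FouriersLaw :=
  closes hW hND hPD
    Summit.AtomisticToContinuum.FouriersLaw.Theorems.AbelOfSpectralDensity.latticeLandauDamping_abelOfSpectralDensity_proof
    (AbelThermodynamicLimit_of_items hR hW hND hPD) NessUnique_holds FiniteResponseOfUnique_holds

end Summit.AtomisticToContinuum.FouriersLaw.Cruxes.AbelThermodynamicLimit.WindowRegularity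

end
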